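import Summits.AtomisticToContinuum.FouriersLaw.Theorems.VanishingNoiseTransferVanishingNoiseBoundFlipBondCurrents

/-!
# The noisy response coefficient as an end-temperature slope; the equilibrium point of the response quotient
(brick for crux stmt-AtomisticToContinuum-11976 `VanishingNoiseTransfer.VanishingNoiseBound`, line
`fekete-usc-one-length`, stub S3 `stub_noisyPositiveConductance`; worker file, the S3 frame)

The frame of stub S3: parameters `ω₂, lam, β, γ > 0`, a temperature `T > 0`, a flip rate `ε`, a family
`μ N T_L T_R` of weak flip steady states (`IsFlipSteadyState`) for all `N` and all `T_L, T_R > 0`, and response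
coefficients `D N = lim_{δ→0, δ≠0} totalCurrent(μ_{N,T+δ/2,T−δ/2})/δ`. S3 claims `0 < D N` for `N ≥ 2`.
This file records what the tree proves about `D N` WITHOUT any semigroup / linear-response theory:

* `totalCurrent_family_eq` — for `|δ| < 2T`: `totalCurrent(μ_{N,T+δ/2,T−δ/2}) = (N−1) γ (T + δ/2 − ⟨p_0²⟩_δ)`
  (files 1–3: energy bookkeeping of weak flip steady states, no moment hypothesis);
* `stubS3_responseAsEndSlope` (registered sub-goal) — hence for `N ≥ 2` the left-end kinetic temperature has a
  slope at `δ = 0` along the family and `(T + δ/2 − ⟨p_0²⟩_δ)/δ → D N / ((N−1)γ)`;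
  `response_pos_iff_end_slope_lt_half` — **S3 ⇔ `lim_{δ→0} (⟨p_0²⟩_δ − T)/δ < 1/2`**: the chain conducts iff
  the left end does NOT thermalise with its own bath to first order in the bias (it is `= 1/2` for a severed
  chain, `V' ≡ 0`); `end_to_end_drop_slope` — the same with the end-to-end drop
  `(⟨p_0²⟩_δ − ⟨p_{N-1}²⟩_δ)/δ → 1 − 2 D N/((N−1)γ)`;
* the equilibrium point, using the UNIQUENESS clause of the frame: `μ N T T` is the Gibbs measure
  (`family_eq_gibbsMeasure`, from `pinnedChain_isFlipSteadyState_gibbsMeasure`), it carries no current, and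
  `D N` is an honest derivative at `δ = 0` of `δ ↦ totalCurrent(μ_{N,T+δ/2,T−δ/2})` (`hasDerivAt_totalCurrent`);
  `response_eq_zero_of_le_one` — `D 0 = D 1 = 0` (no bond).

What is NOT here (and blocks S3): the sign of the slope. Print: `D N = (N−1) T⁻² ∫₀^∞ ⟨j_b(0) j_b(t)⟩_{T,ε} dt ≥ 0`
(finite-volume Green–Kubo, Bonetto–Lebowitz–Rey-Bellet 2000 eq. (32) "not proved"; Rey-Bellet 2003 Rem. 4.4
(56)), strict by non-degeneracy of the flip Dirichlet form; it needs the `L²(Gibbs)` resolvent of `L_T + εS` and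
first-order perturbation theory of the weak NESS in `δ`, neither of which exists in the tree (cf. the open route
items `FiniteResponseOfUnique` stmt-0717 / `JunctionLocality.PositiveConductance` stmt-11750 at `ε = 0`).
-/

noncomputable section

namespace Summit.AtomisticToContinuum.FouriersLaw.Theorems.VanishingNoiseBound

open MeasureTheory Filter Topology Set
open scoped NNReal ENNReal
open Literature.MathematicalPhysics.KineticTheory
open Literature.MathematicalPhysics.KineticTheory.HeatConduction

section Frame

variable {ω₂ lam β γ : ℝ}

/-- Near `δ = 0` both bias temperatures `T ± δ/2` are positive. [folklore] -/
theorem eventually_abs_lt_two_mul {T : ℝ} (hT : 0 < T) : ∀ᶠ δ : ℝ in 𝓝[≠] 0, |δ| < 2 * T := by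
  have h : Metric.ball (0 : ℝ) (2 * T) ∈ 𝓝 (0 : ℝ) := Metric.ball_mem_nhds 0 (by positivity)
  filter_upwards [nhdsWithin_le_nhds h] with δ hδ
  simpa [Metric.mem_ball, Real.dist_eq] using hδ

/-- **The current of the biased family in terms of the left-end kinetic temperature.** In the frame of S3
(flip-steady family `μ`, parameters `> 0`, here `lam, β ≥ 0` suffice), for `N ≥ 1` and `|δ| < 2T`:
`totalCurrent(μ_{N,T+δ/2,T−δ/2}) = (N − 1) γ (T + δ/2 − ∫ p_0² dμ_{N,T+δ/2,T−δ/2})`.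
[Bonetto–Lebowitz–Rey-Bellet 2000, §5.2 eq. (27)] [folklore] -/
theorem totalCurrent_family_eq (hω : 0 < ω₂) (hl : 0 ≤ lam) (hβ : 0 ≤ β) (hγ : 0 < γ) {T : ℝ} {ε : ℝ}
    {μ : (N : ℕ) → ℝ → ℝ → Measure (PhaseSpace N)}
    (hμ : ∀ (N : ℕ) (T_L T_R : ℝ), 0 < T_L → 0 < T_R →
      (pinnedChain ω₂ lam β γ).IsFlipSteadyState N T_L T_R ε (μ N T_L T_R))
    {N : ℕ} (hN : 0 < N) {δ : ℝ} (hδ : |δ| < 2 * T) :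
    (pinnedChain ω₂ lam β γ).totalCurrent (μ N (T + δ / 2) (T - δ / 2)) =
      ((N : ℝ) - 1) * γ * (T + δ / 2 - ∫ x, x.2 ⟨0, hN⟩ ^ 2 ∂(μ N (T + δ / 2) (T - δ / 2))) := by
  obtain ⟨h1, h2⟩ := abs_lt.mp hδ
  have hL : 0 < T + δ / 2 := by linarith
  have hR : 0 < T - δ / 2 := by linarith
  exact totalCurrent_eq_left hω hl hβ hγ hN hL.le hR.le (hμ N _ _ hL hR)

/-- **Registered sub-goal `stubS3_responseAsEndSlope`** (brick for stub S3 `stub_noisyPositiveConductance` of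
crux stmt-AtomisticToContinuum-11976). In the frame of S3 (no uniqueness needed), for `N ≥ 2` the response
coefficient is `(N−1)γ` times the first-order deficit of the left-end kinetic temperature below its bath:
`(T + δ/2 − ∫ p_0² dμ_{N,T+δ/2,T−δ/2})/δ → D N / ((N−1)γ)` as `δ → 0`, `δ ≠ 0`.
[Bonetto–Lebowitz–Rey-Bellet 2000, §5.2–5.3] [folklore] -/
theorem stubS3_responseAsEndSlope :
    ∀ ω₂ lam β γ : ℝ, 0 < ω₂ → 0 < lam → 0 < β → 0 < γ → ∀ T : ℝ, 0 < T → ∀ ε : ℝ,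
      ∀ μ : (N : ℕ) → ℝ → ℝ → Measure (PhaseSpace N),
        (∀ (N : ℕ) (T_L T_R : ℝ), 0 < T_L → 0 < T_R →
          (pinnedChain ω₂ lam β γ).IsFlipSteadyState N T_L T_R ε (μ N T_L T_R)) →
        ∀ D : ℕ → ℝ,
          (∀ N : ℕ, Tendsto (fun δ : ℝ =>
            (pinnedChain ω₂ lam β γ).totalCurrent (μ N (T + δ / 2) (T - δ / 2)) / δ)
            (𝓝[≠] 0) (𝓝 (D N))) →
          ∀ (N : ℕ) (hN : 0 < N), 2 ≤ N →
            Tendsto (fun δ : ℝ =>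
              (T + δ / 2 - ∫ x, x.2 ⟨0, hN⟩ ^ 2 ∂(μ N (T + δ / 2) (T - δ / 2))) / δ)
              (𝓝[≠] 0) (𝓝 (D N / (((N : ℝ) - 1) * γ))) := by
  intro ω₂ lam β γ hω hl hβ hγ T hT ε μ hμ D hD N hN h2
  have hc : ((N : ℝ) - 1) * γ ≠ 0 := by
    have : (2 : ℝ) ≤ N := by exact_mod_cast h2
    have : 0 < ((N : ℝ) - 1) * γ := by nlinarith
    exact this.ne'
  refine ((hD N).div_const (((N : ℝ) - 1) * γ)).congr' ?_
  filter_upwards [eventually_abs_lt_two_mul hT] with δ hδ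
  rw [totalCurrent_family_eq hω hl.le hβ.le hγ hμ hN hδ, mul_div_assoc, mul_div_cancel_left₀ _ hc]

/-- **The left-end kinetic temperature has a slope at zero bias** (frame of S3, `N ≥ 2`):
`(∫ p_0² dμ_{N,T+δ/2,T−δ/2} − T)/δ → 1/2 − D N/((N−1)γ)`. [folklore] -/
theorem end_temperature_slope (hω : 0 < ω₂) (hl : 0 < lam) (hβ : 0 < β) (hγ : 0 < γ) {T : ℝ}
    (hT : 0 < T) {ε : ℝ} {μ : (N : ℕ) → ℝ → ℝ → Measure (PhaseSpace N)}
    (hμ : ∀ (N : ℕ) (T_L T_R : ℝ), 0 < T_L → 0 < T_R →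
      (pinnedChain ω₂ lam β γ).IsFlipSteadyState N T_L T_R ε (μ N T_L T_R))
    {D : ℕ → ℝ} (hD : ∀ N : ℕ, Tendsto (fun δ : ℝ =>
      (pinnedChain ω₂ lam β γ).totalCurrent (μ N (T + δ / 2) (T - δ / 2)) / δ) (𝓝[≠] 0) (𝓝 (D N)))
    {N : ℕ} (hN : 0 < N) (h2 : 2 ≤ N) :
    Tendsto (fun δ : ℝ => ((∫ x, x.2 ⟨0, hN⟩ ^ 2 ∂(μ N (T + δ / 2) (T - δ / 2))) - T) / δ)
      (𝓝[≠] 0) (𝓝 (1 / 2 - D N / (((N : ℝ) - 1) * γ))) := by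
  have h := stubS3_responseAsEndSlope ω₂ lam β γ hω hl hβ hγ T hT ε μ hμ D hD N hN h2
  refine ((tendsto_const_nhds (x := (1 : ℝ) / 2)).sub h).congr' ?_
  filter_upwards [self_mem_nhdsWithin] with δ hδ
  have hδ' : δ ≠ 0 := hδ
  field_simp
  ring

/-- **S3 rephrased: the chain conducts iff its left end does not thermalise with its own bath to first
order.** In the frame of S3 (`N ≥ 2`), if `s` is the slope of the left-end kinetic temperature at zero bias
(it exists, `end_temperature_slope`), then `0 < D N ↔ s < 1/2`. [folklore] -/
theorem response_pos_iff_end_slope_lt_half (hω : 0 < ω₂) (hl : 0 < lam) (hβ : 0 < β) (hγ : 0 < γ)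
    {T : ℝ} (hT : 0 < T) {ε : ℝ} {μ : (N : ℕ) → ℝ → ℝ → Measure (PhaseSpace N)}
    (hμ : ∀ (N : ℕ) (T_L T_R : ℝ), 0 < T_L → 0 < T_R →
      (pinnedChain ω₂ lam β γ).IsFlipSteadyState N T_L T_R ε (μ N T_L T_R))
    {D : ℕ → ℝ} (hD : ∀ N : ℕ, Tendsto (fun δ : ℝ =>
      (pinnedChain ω₂ lam β γ).totalCurrent (μ N (T + δ / 2) (T - δ / 2)) / δ) (𝓝[≠] 0) (𝓝 (D N)))
    {N : ℕ} (hN : 0 < N) (h2 : 2 ≤ N) {s : ℝ}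
    (hs : Tendsto (fun δ : ℝ => ((∫ x, x.2 ⟨0, hN⟩ ^ 2 ∂(μ N (T + δ / 2) (T - δ / 2))) - T) / δ)
      (𝓝[≠] 0) (𝓝 s)) :
    0 < D N ↔ s < 1 / 2 := by
  have hs' := tendsto_nhds_unique hs (end_temperature_slope hω hl hβ hγ hT hμ hD hN h2)
  have hc : 0 < ((N : ℝ) - 1) * γ := by
    have : (2 : ℝ) ≤ N := by exact_mod_cast h2
    nlinarith
  rw [hs']
  constructor
  · intro h
    have := div_pos h hc
    linarith
  · intro h
    have h1 : 0 < D N / (((N : ℝ) - 1) * γ) := by linarith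
    exact (div_pos_iff_of_pos_right hc).mp h1

/-- **… equivalently, the end-to-end kinetic temperature drop is smaller than the bath bias to first order.**
In the frame of S3 (`N ≥ 2`): `(∫ p_0² dμ_δ − ∫ p_{N-1}² dμ_δ)/δ → 1 − 2 D N/((N−1)γ)` (the two end temperatures
add up to `2T`, file 2/3), so `0 < D N ↔` this slope is `< 1` (a severed chain has slope `1`: each end
thermalises with its own bath). [folklore] -/
theorem end_to_end_drop_slope (hω : 0 < ω₂) (hl : 0 < lam) (hβ : 0 < β) (hγ : 0 < γ) {T : ℝ}
    (hT : 0 < T) {ε : ℝ} {μ : (N : ℕ) → ℝ → ℝ → Measure (PhaseSpace N)}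
    (hμ : ∀ (N : ℕ) (T_L T_R : ℝ), 0 < T_L → 0 < T_R →
      (pinnedChain ω₂ lam β γ).IsFlipSteadyState N T_L T_R ε (μ N T_L T_R))
    {D : ℕ → ℝ} (hD : ∀ N : ℕ, Tendsto (fun δ : ℝ =>
      (pinnedChain ω₂ lam β γ).totalCurrent (μ N (T + δ / 2) (T - δ / 2)) / δ) (𝓝[≠] 0) (𝓝 (D N)))
    {N : ℕ} (hN : 0 < N) (h2 : 2 ≤ N) :
    Tendsto (fun δ : ℝ => ((∫ x, x.2 ⟨0, hN⟩ ^ 2 ∂(μ N (T + δ / 2) (T - δ / 2))) -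
        ∫ x, x.2 ⟨N - 1, Nat.sub_lt hN one_pos⟩ ^ 2 ∂(μ N (T + δ / 2) (T - δ / 2))) / δ)
      (𝓝[≠] 0) (𝓝 (1 - 2 * (D N / (((N : ℝ) - 1) * γ)))) := by
  have h := end_temperature_slope hω hl hβ hγ hT hμ hD hN h2
  have e : (1 : ℝ) - 2 * (D N / (((N : ℝ) - 1) * γ)) = 2 * (1 / 2 - D N / (((N : ℝ) - 1) * γ)) := by ring
  rw [e]
  refine (h.const_mul 2).congr' ?_
  filter_upwards [eventually_abs_lt_two_mul hT] with δ hδ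
  obtain ⟨h1, h2'⟩ := abs_lt.mp hδ
  have hL : 0 < T + δ / 2 := by linarith
  have hR : 0 < T - δ / 2 := by linarith
  have hsum := integral_sq_momentum_ends hω hl.le hβ.le hγ hN (hμ N _ _ hL hR)
  rw [mul_div_assoc']
  congr 1
  linarith

/-! ### The equilibrium point of the response quotient (uses the uniqueness clause of the frame) -/

/-- **At zero bias the unique flip steady state is the Gibbs measure** (`ω₂ > 0`, `lam, β ≥ 0`, any `γ`, any
rate `ε`, `T > 0`): the Gibbs measure is a flip steady state (`pinnedChain_isFlipSteadyState_gibbsMeasure`),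
hence equal to `μ N T T` by the uniqueness clause of the frame.
[Bernardin–Olla 2011, §2.1 ("the Gibbs measure … is invariant")] [folklore] -/
theorem family_eq_gibbsMeasure (hω : 0 < ω₂) (hl : 0 ≤ lam) (hβ : 0 ≤ β) (γ ε : ℝ)
    {μ : (N : ℕ) → ℝ → ℝ → Measure (PhaseSpace N)}
    (hμ : ∀ (N : ℕ) (T_L T_R : ℝ), 0 < T_L → 0 < T_R →
      (pinnedChain ω₂ lam β γ).IsFlipSteadyState N T_L T_R ε (μ N T_L T_R) ∧
        ∀ ν : Measure (PhaseSpace N),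
          (pinnedChain ω₂ lam β γ).IsFlipSteadyState N T_L T_R ε ν → ν = μ N T_L T_R)
    (N : ℕ) {T : ℝ} (hT : 0 < T) :
    μ N T T = (pinnedChain ω₂ lam β γ).gibbsMeasure N T :=
  ((hμ N T T hT hT).2 _ (pinnedChain_isFlipSteadyState_gibbsMeasure hω hl hβ γ N hT ε)).symm

/-- **No current at zero bias**: `totalCurrent (μ N T T) = 0` for the unique flip-steady family (momentum
reversal symmetry of the Gibbs measure, `pinnedChain_totalCurrent_gibbsMeasure`). [folklore] -/
theorem totalCurrent_family_self (hω : 0 < ω₂) (hl : 0 ≤ lam) (hβ : 0 ≤ β) (γ ε : ℝ)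
    {μ : (N : ℕ) → ℝ → ℝ → Measure (PhaseSpace N)}
    (hμ : ∀ (N : ℕ) (T_L T_R : ℝ), 0 < T_L → 0 < T_R →
      (pinnedChain ω₂ lam β γ).IsFlipSteadyState N T_L T_R ε (μ N T_L T_R) ∧
        ∀ ν : Measure (PhaseSpace N),
          (pinnedChain ω₂ lam β γ).IsFlipSteadyState N T_L T_R ε ν → ν = μ N T_L T_R)
    (N : ℕ) {T : ℝ} (hT : 0 < T) :
    (pinnedChain ω₂ lam β γ).totalCurrent (μ N T T) = 0 := by
  rw [family_eq_gibbsMeasure hω hl hβ γ ε hμ N hT]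
  exact pinnedChain_totalCurrent_gibbsMeasure ω₂ lam β γ N T

/-- **The response coefficient is a derivative at an equilibrium zero**: along the unique flip-steady family,
`δ ↦ totalCurrent(μ_{N,T+δ/2,T−δ/2})` vanishes at `δ = 0` and has derivative `D N` there. [folklore] -/
theorem hasDerivAt_totalCurrent (hω : 0 < ω₂) (hl : 0 ≤ lam) (hβ : 0 ≤ β) (γ ε : ℝ)
    {μ : (N : ℕ) → ℝ → ℝ → Measure (PhaseSpace N)}
    (hμ : ∀ (N : ℕ) (T_L T_R : ℝ), 0 < T_L → 0 < T_R →
      (pinnedChain ω₂ lam β γ).IsFlipSteadyState N T_L T_R ε (μ N T_L T_R) ∧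
        ∀ ν : Measure (PhaseSpace N),
          (pinnedChain ω₂ lam β γ).IsFlipSteadyState N T_L T_R ε ν → ν = μ N T_L T_R)
    {T : ℝ} (hT : 0 < T) {D : ℕ → ℝ} (hD : ∀ N : ℕ, Tendsto (fun δ : ℝ =>
      (pinnedChain ω₂ lam β γ).totalCurrent (μ N (T + δ / 2) (T - δ / 2)) / δ) (𝓝[≠] 0) (𝓝 (D N)))
    (N : ℕ) :
    HasDerivAt (fun δ : ℝ => (pinnedChain ω₂ lam β γ).totalCurrent (μ N (T + δ / 2) (T - δ / 2)))
      (D N) 0 := by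
  rw [hasDerivAt_iff_tendsto_slope_zero]
  refine (hD N).congr' (Eventually.of_forall fun δ => ?_)
  have h0 : (pinnedChain ω₂ lam β γ).totalCurrent (μ N (T + 0 / 2) (T - 0 / 2)) = 0 := by
    rw [zero_div, add_zero, sub_zero]
    exact totalCurrent_family_self hω hl hβ γ ε hμ N hT
  simp only [zero_add, h0, sub_zero, smul_eq_mul]
  rw [div_eq_inv_mul]

/-- **No bond, no response**: `D N = 0` for `N ≤ 1` (the total current of a chain without bonds vanishes
identically). [folklore] -/
theorem response_eq_zero_of_le_one (P : OscillatorChain) {T : ℝ}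
    {μ : (N : ℕ) → ℝ → ℝ → Measure (PhaseSpace N)} {D : ℕ → ℝ}
    (hD : ∀ N : ℕ, Tendsto (fun δ : ℝ => P.totalCurrent (μ N (T + δ / 2) (T - δ / 2)) / δ)
      (𝓝[≠] 0) (𝓝 (D N))) {N : ℕ} (hN : N ≤ 1) : D N = 0 := by
  have hzero : ∀ ν : Measure (PhaseSpace N), P.totalCurrent ν = 0 := by
    intro ν
    unfold OscillatorChain.totalCurrent
    refine Finset.sum_eq_zero fun i _ => ?_
    have hi : N ≤ i.val + 1 := by have := i.isLt; omega
    simp [P.bondCurrent_eq_zero_of_le i hi]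
  have h := hD N
  simp only [hzero, zero_div] at h
  exact tendsto_nhds_unique h tendsto_const_nhds

end Frame

end Summit.AtomisticToContinuum.FouriersLaw.Theorems.VanishingNoiseBound

end
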